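import Summits.KontsevichZagierPeriods.KontsevichZagierPeriods.Theorems.LinRedNormalFormArrangementNormalFormStubRebaseSimplePosOnePosParTripleTools

/-!
# Stub `stub_rebaseSimplePosOnePos` (crux `ArrangementNormalForm`, line `janus-bands`) —
part `ParTriple`: flat cells WITHOUT TRIPLE POINT are closed (any base dimension)

The residual hypothesis `HparFlat` of part `Flats` (parallel transverse bands, letter `0`,
bounds `0 < u < v` with common slope `s ≠ 0`, base pole `1/(y − ℓ₂(x'))`, over a product cell
`{x'-rows M₀} × (ylo(x'), yhi(x'))` whose closed cell meets the flat `{h = 0} ∩ {w = 0}`,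
`h = yhi − ylo`, `w = v − u`) is cut down to TRIPLE POINTS. Write `κ'(x') = u₀(x') + s ℓ₂(x')`
for the value of the lower bound on the pole hyperplane `y = ℓ₂(x')` (`u = s y + u₀`); after the
shear `t' = t − u` the quantity `D = t − s (y − ℓ₂)` ranges over `(κ', κ' + w)`, and the partial
fractions in `y` of part `ParDual` are dominated as soon as `D` stays away from `0`
(`RebasePos.good_parCell_offCoincidence`: `|s (y − ℓ₂)| ≤ R₀` on the bounded domain and
`|D| ≥ μ/2` give the constant `C = 1 + 2 R₀/μ`; the swapped band is closed by one dual level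
split where `w < |s| h`). `RebasePos.good_parCell_of_noTriple`: if NO point of the closed cell
has `h = w = κ' = 0`, then by the extreme value theorem `max (h, w, |κ'|) ≥ μ > 0` on the compact
closure of the domain; cut at `h = δ` with `0 < δ < μ`, `|s| δ < μ/2` (rule 1a; far part
non-pinching, `good_parNonpinch'`), then by `w = |s| h` (`|s| h ≤ w`: one level split,
`good_parLevel`), then by the sign of `κ'` (where `h < δ` and `w < |s| h < μ/2` one has
`|κ'| ≥ μ`, so `D > κ' ≥ μ` resp. `D < κ' + w ≤ −μ/2`): `good_parCell_offCoincidence`.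
Registered as `rebaseSimplePos_par_noTriple`. Residue of `Hpar` in any base dimension: product
cells whose closed cell contains a TRIPLE point `h = w = κ' = 0` (assembled in part `ParTripleFlat`).

References: M. Kontsevich, D. Zagier, *Periods* (2001), §1.2, rules (1a), (1b), (2).
-/

noncomputable section

open Set MeasureTheory MvPolynomial
open Literature.NumberTheory.Transcendental Literature.ModelTheory.ExponentialFields

namespace Summit.KontsevichZagierPeriods.ArrangementNormalForm.JanusBands

namespace RebasePos

open SeparatePos

section Triple

variable {B m m' m₀ : ℕ} (L : Fin m → (Fin B → ℚ) × ℚ) (e : Fin m → ℕ) (ℓ₁ ℓ₂ : (Fin B → ℚ) × ℚ)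

/-- **Parallel bands over a product cell, OFF THE COINCIDENCE `D = 0`.** Data of `Hpar` over a
product cell (`hsec`, non-degenerate `y`-range `hne`, pole outside the range `hpole`) such that
on the `x'`-cell `ε κ' ≥ μ > 0` (`hk`, `ε = ±1`, `κ' = u₀ + s ℓ₂`), `w < |s| h` and `w ≤ μ/2`
(`hw`), and `|s (y − ℓ₂)| ≤ R₀` over the band (`hRT`): then `D = t − s (y − ℓ₂) ∈ (κ', κ' + w)`
satisfies `|D| ≥ μ/2`, the partial fractions of part `ParDual` are dominated with
`C = 1 + 2 R₀/μ`, and one dual level split closes the swapped band. -/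
theorem good_parCell_offCoincidence (s : KZ.IntegralRep (B + 1 + 1)) (M : Fin m' → (Fin (B + 1) → ℚ) × ℚ)
    (M₀ : Fin m₀ → (Fin B → ℚ) × ℚ) (ylo yhi : (Fin B → ℚ) × ℚ) (p : MvPolynomial (Fin B) ℚ)
    (u v : (Fin (B + 1) → ℚ) × ℚ) (hbd : Bornology.IsBounded s.domain)
    (hdom : s.domain = gDom B 1 m' M (fun _ => Sum.inr u) (fun _ => Sum.inr v))
    (hint : EqOn s.integrand (glit B 1 p L e ℓ₁ ℓ₂ 0 1 (fun _ => some 0)) s.domain)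
    (hu : u.1 (Fin.last B) ≠ 0) (hpar : u.1 (Fin.last B) = v.1 (Fin.last B))
    (hcell : ∀ z : Fin (B + 1 + 1) → ℝ, (∀ j, 0 < affF B 1 (M j) z) → 0 < affF B 1 u z ∧ affF B 1 u z < affF B 1 v z)
    (hsec : ∀ z : Fin (B + 1 + 1) → ℝ, (∀ j, 0 < affF B 1 (M j) z) ↔ ((∀ j, 0 < affB B 1 (M₀ j) z) ∧
      affB B 1 ylo z < z (Fin.castAdd 1 (Fin.last B)) ∧ z (Fin.castAdd 1 (Fin.last B)) < affB B 1 yhi z))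
    (hne : ∀ z : Fin (B + 1 + 1) → ℝ, (∀ j, 0 < affB B 1 (M₀ j) z) → affB B 1 ylo z < affB B 1 yhi z)
    (hpole : ∀ z : Fin (B + 1 + 1) → ℝ, (∀ j, 0 < affB B 1 (M₀ j) z) →
      affB B 1 ℓ₂ z ≤ affB B 1 ylo z ∨ affB B 1 yhi z ≤ affB B 1 ℓ₂ z)
    (μ R₀ ε : ℝ) (hμ : 0 < μ) (hR : 0 ≤ R₀) (hε : ε = 1 ∨ ε = -1)
    (hk : ∀ z : Fin (B + 1 + 1) → ℝ, (∀ j, 0 < affB B 1 (M₀ j) z) →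
      μ ≤ ε * (affB B 1 (restr B u) z + (u.1 (Fin.last B) : ℝ) * affB B 1 ℓ₂ z))
    (hw : ∀ z : Fin (B + 1 + 1) → ℝ, (∀ j, 0 < affB B 1 (M₀ j) z) →
      affF B 1 v z - affF B 1 u z < |(u.1 (Fin.last B) : ℝ)| * (affB B 1 yhi z - affB B 1 ylo z) ∧
      affF B 1 v z - affF B 1 u z ≤ μ / 2)
    (hRT : ∀ z : Fin (B + 1 + 1) → ℝ, (∀ j, 0 < affF B 1 (M j) z) → ∀ T : ℝ, affF B 1 u z < T →
      T < affF B 1 v z → |(u.1 (Fin.last B) : ℝ) * (z (Fin.castAdd 1 (Fin.last B)) - affB B 1 ℓ₂ z)| ≤ R₀) :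
    ∃ c ∈ AddSubgroup.closure (GGset B 2 1), KZ.of s - c ∈ KZ.relations := by
  set sR : ℝ := (u.1 (Fin.last B) : ℝ) with hsR
  have hs0 : 0 < |sR| := abs_pos.2 (by rw [hsR]; exact_mod_cast hu)
  have hwz : ∀ z : Fin (B + 1 + 1) → ℝ, affF B 1 v z - affF B 1 u z =
      affB B 1 (restr B v) z - affB B 1 (restr B u) z := fun z => width_eq u v hpar z
  refine good_parDominated L e ℓ₁ ℓ₂ s M M₀ ylo yhi p u v hbd hdom hint hu hpar hcell hsec hne hpole
    (1 + 2 * R₀ / μ) (fun z hz T hT1 hT2 => ?_) (Or.inr ⟨0, fun z hz => ?_⟩)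
  · obtain ⟨h0, -, -⟩ := (hsec z).1 hz
    set D : ℝ := T - sR * (z (Fin.castAdd 1 (Fin.last B)) - affB B 1 ℓ₂ z) with hD
    have hus := affF_split u z
    have hvs := affF_split v z
    rw [← hpar] at hvs
    -- `ε D ≥ μ/2`
    have hD1 : μ / 2 ≤ ε * D := by
      obtain ⟨hw1, hw2⟩ := hw z h0
      have hkz := hk z h0
      rcases hε with rfl | rfl
      · rw [one_mul] at hkz ⊢
        have : affB B 1 (restr B u) z + sR * affB B 1 ℓ₂ z < D := by rw [hD, hsR]; linarith
        linarith
      · rw [neg_one_mul] at hkz ⊢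
        have : D < affB B 1 (restr B u) z + sR * affB B 1 ℓ₂ z + (affF B 1 v z - affF B 1 u z) := by
          rw [hD, hsR, hwz]; linarith
        linarith
    have hDabs : μ / 2 ≤ |D| := by
      refine hD1.trans ?_
      rcases hε with rfl | rfl
      · rw [one_mul]; exact le_abs_self D
      · rw [neg_one_mul]; exact neg_le_abs D
    have hY := hRT z hz T hT1 hT2
    have hRD : R₀ ≤ 2 * R₀ / μ * |D| := by
      rw [div_mul_eq_mul_div, le_div_iff₀ hμ]
      nlinarith [hDabs, hR]
    have hDn : 0 ≤ |D| := abs_nonneg D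
    have hT : T = D + sR * (z (Fin.castAdd 1 (Fin.last B)) - affB B 1 ℓ₂ z) := by rw [hD]; ring
    refine ⟨?_, ?_⟩
    · calc |T| ≤ |D| + |sR * (z (Fin.castAdd 1 (Fin.last B)) - affB B 1 ℓ₂ z)| := by
            rw [hT]; exact abs_add_le _ _
        _ ≤ |D| + 2 * R₀ / μ * |D| := by linarith
        _ = (1 + 2 * R₀ / μ) * |D| := by ring
    · calc |sR * (z (Fin.castAdd 1 (Fin.last B)) - affB B 1 ℓ₂ z)| ≤ 2 * R₀ / μ * |D| := hY.trans hRD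
        _ ≤ (1 + 2 * R₀ / μ) * |D| := by nlinarith [hDn]
  · obtain ⟨hw1, -⟩ := hw z hz
    rw [Nat.cast_zero, zero_add, one_mul, inv_mul_le_iff₀ hs0]
    exact hw1.le

/-- **A flat cell WITHOUT TRIPLE POINT is closed** (any base dimension). Data of `Hpar` over a
product cell (`hsec`, non-degenerate `y`-range, pole outside the range) such that no point `z`
of the closed cell `closure {rows > 0}` has `ylo(z) = yhi(z)`, `u(z) = v(z)` AND `κ'(z) = 0`
(`hnt`, `κ' = u₀ + s ℓ₂`): `[s]` is congruent modulo `KZ.relations` to the subgroup generated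
by `GG B 2 1`. See the module docstring (extreme value theorem for `max (h, w, |κ'|)`, three
cuts, `good_parNonpinch'` / `good_parLevel` / `good_parCell_offCoincidence`). -/
theorem good_parCell_of_noTriple (s : KZ.IntegralRep (B + 1 + 1)) (M : Fin m' → (Fin (B + 1) → ℚ) × ℚ)
    (M₀ : Fin m₀ → (Fin B → ℚ) × ℚ) (ylo yhi : (Fin B → ℚ) × ℚ) (p : MvPolynomial (Fin B) ℚ)
    (u v : (Fin (B + 1) → ℚ) × ℚ) (hbd : Bornology.IsBounded s.domain)
    (hdom : s.domain = gDom B 1 m' M (fun _ => Sum.inr u) (fun _ => Sum.inr v))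
    (hint : EqOn s.integrand (glit B 1 p L e ℓ₁ ℓ₂ 0 1 (fun _ => some 0)) s.domain)
    (hu : u.1 (Fin.last B) ≠ 0) (hpar : u.1 (Fin.last B) = v.1 (Fin.last B))
    (hcell : ∀ z : Fin (B + 1 + 1) → ℝ, (∀ j, 0 < affF B 1 (M j) z) → 0 < affF B 1 u z ∧ affF B 1 u z < affF B 1 v z)
    (hsec : ∀ z : Fin (B + 1 + 1) → ℝ, (∀ j, 0 < affF B 1 (M j) z) ↔ ((∀ j, 0 < affB B 1 (M₀ j) z) ∧
      affB B 1 ylo z < z (Fin.castAdd 1 (Fin.last B)) ∧ z (Fin.castAdd 1 (Fin.last B)) < affB B 1 yhi z))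
    (hne : ∀ z : Fin (B + 1 + 1) → ℝ, (∀ j, 0 < affB B 1 (M₀ j) z) → affB B 1 ylo z < affB B 1 yhi z)
    (hpole : ∀ z : Fin (B + 1 + 1) → ℝ, (∀ j, 0 < affB B 1 (M₀ j) z) →
      affB B 1 ℓ₂ z ≤ affB B 1 ylo z ∨ affB B 1 yhi z ≤ affB B 1 ℓ₂ z)
    (hnt : ∀ z ∈ closure {z : Fin (B + 1 + 1) → ℝ | ∀ j, 0 < affF B 1 (M j) z},
      affB B 1 ylo z = affB B 1 yhi z → affF B 1 u z = affF B 1 v z →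
      affB B 1 (restr B u) z + (u.1 (Fin.last B) : ℝ) * affB B 1 ℓ₂ z = 0 → False) :
    ∃ c ∈ AddSubgroup.closure (GGset B 2 1), KZ.of s - c ∈ KZ.relations := by
  set sq : ℚ := u.1 (Fin.last B) with hsq
  set sR : ℝ := (sq : ℝ) with hsR
  have hs0 : 0 < |sR| := abs_pos.2 (by rw [hsR, hsq]; exact_mod_cast hu)
  -- height, width, `κ'` as `x'`-forms
  set hF : (Fin B → ℚ) × ℚ := yhi - ylo with hhF
  set wF : (Fin B → ℚ) × ℚ := restr B v - restr B u with hwF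
  set kF : (Fin B → ℚ) × ℚ := restr B u - (-sq) • ℓ₂ with hkF
  have hhz : ∀ z : Fin (B + 1 + 1) → ℝ, affB B 1 hF z = affB B 1 yhi z - affB B 1 ylo z :=
    fun z => by rw [hhF, affB_sub]
  have hwz : ∀ z : Fin (B + 1 + 1) → ℝ, affB B 1 wF z = affF B 1 v z - affF B 1 u z :=
    fun z => by rw [hwF, affB_sub, width_eq u v hpar]
  have hkz : ∀ z : Fin (B + 1 + 1) → ℝ, affB B 1 kF z = affB B 1 (restr B u) z + sR * affB B 1 ℓ₂ z :=
    fun z => by rw [hkF, affB_sub, affB_smul', hsR]; push_cast; ring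
  -- on the base cell the height and the width are positive
  have hpos : ∀ z : Fin (B + 1 + 1) → ℝ, (∀ j, 0 < affF B 1 (M j) z) →
      0 < affB B 1 hF z ∧ 0 < affB B 1 wF z := fun z hz => by
    obtain ⟨-, hlo, hhi⟩ := (hsec z).1 hz
    obtain ⟨-, huv⟩ := hcell z hz
    rw [hhz, hwz]
    exact ⟨by linarith, by linarith⟩
  -- an empty base cell
  have hempty : (∀ z : Fin (B + 1 + 1) → ℝ, ¬ (∀ j, 0 < affF B 1 (M j) z)) →
      ∃ c ∈ AddSubgroup.closure (GGset B 2 1), KZ.of s - c ∈ KZ.relations := fun h => by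
    refine good_of_null s ?_
    rw [hdom]
    exact measure_mono_null (fun z hz => (h z ((mem_gDom_one M u v z).1 hz).1).elim) measure_empty
  -- constant height
  by_cases ha0 : hF.1 = 0
  · have hconst : ∀ z : Fin (B + 1 + 1) → ℝ, affB B 1 hF z = hF.2 := fun z => by
      simp [affB, ha0]
    by_cases hb0 : hF.2 ≤ 0
    · refine hempty fun z hz => ?_
      have h := (hpos z hz).1
      rw [hconst] at h
      have : ((hF.2 : ℚ) : ℝ) ≤ 0 := by exact_mod_cast hb0
      linarith
    · push Not at hb0
      exact good_parNonpinch' L e ℓ₁ ℓ₂ s M M₀ ylo yhi p u v hbd hdom hint hu hpar hcell hsec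
        ⟨hF.2, by exact_mod_cast hb0, fun z _ => by rw [← hhz, hconst]⟩
  -- the level `μ`: minimum of `max (h, w, |κ'|)` on the closure of the domain
  have hdomhw : ∀ z ∈ s.domain, 0 < affB B 1 hF z ∧ 0 < affB B 1 wF z := fun z hz => by
    rw [hdom, mem_gDom_one] at hz
    exact hpos z hz.1
  set φ : (Fin (B + 1 + 1) → ℝ) → ℝ := fun z => max (max (affB B 1 hF z) (affB B 1 wF z)) |affB B 1 kF z| with hφ
  have hφc : Continuous φ :=
    ((continuous_affB_one hF).max (continuous_affB_one wF)).max (continuous_affB_one kF).abs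
  have hK : IsCompact (closure s.domain) := hbd.isCompact_closure
  have hKsub : closure s.domain ⊆ closure {z : Fin (B + 1 + 1) → ℝ | ∀ j, 0 < affF B 1 (M j) z} :=
    closure_mono fun z hz => by
      rw [hdom, mem_gDom_one] at hz
      exact hz.1
  have hKh : ∀ z ∈ closure s.domain, 0 ≤ affB B 1 hF z := fun z hz =>
    closure_minimal (fun z hz => ((hdomhw z hz).1.le : z ∈ {z | 0 ≤ affB B 1 hF z}))
      (isClosed_le continuous_const (continuous_affB_one hF)) hz
  have hKw : ∀ z ∈ closure s.domain, 0 ≤ affB B 1 wF z := fun z hz =>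
    closure_minimal (fun z hz => ((hdomhw z hz).2.le : z ∈ {z | 0 ≤ affB B 1 wF z}))
      (isClosed_le continuous_const (continuous_affB_one wF)) hz
  have hφpos : ∀ z ∈ closure s.domain, 0 < φ z := fun z hz => by
    by_contra hle
    push Not at hle
    have h1 : affB B 1 hF z = 0 :=
      le_antisymm ((le_max_left _ _).trans ((le_max_left _ _).trans hle)) (hKh z hz)
    have h2 : affB B 1 wF z = 0 :=
      le_antisymm ((le_max_right _ _).trans ((le_max_left _ _).trans hle)) (hKw z hz)
    have h3 : |affB B 1 kF z| = 0 := le_antisymm ((le_max_right _ _).trans hle) (abs_nonneg _)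
    rw [hhz, sub_eq_zero] at h1
    rw [hwz, sub_eq_zero] at h2
    rw [abs_eq_zero, hkz] at h3
    exact hnt z (hKsub hz) h1.symm h2.symm h3
  rcases s.domain.eq_empty_or_nonempty with hemp | hne'
  · exact good_of_null s (by rw [hemp, measure_empty])
  obtain ⟨z₀, hz₀, hmin⟩ := hK.exists_isMinOn hne'.closure hφc.continuousOn
  set μ : ℝ := φ z₀ with hμ
  have hμ0 : 0 < μ := hφpos z₀ hz₀
  have hμle : ∀ z ∈ closure s.domain, μ ≤ φ z := fun z hz => hmin hz
  -- the bound `R₀` of `|s (y − ℓ₂)|` on the closure of the domain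
  set ψ : (Fin (B + 1 + 1) → ℝ) → ℝ := fun z => |sR * (z (Fin.castAdd 1 (Fin.last B)) - affB B 1 ℓ₂ z)| with hψ
  have hψc : Continuous ψ := by
    rw [hψ]
    exact (continuous_const.mul ((continuous_apply _).sub (continuous_affB_one ℓ₂))).abs
  obtain ⟨z₁, hz₁, hmax⟩ := hK.exists_isMaxOn hne'.closure hψc.continuousOn
  set R₀ : ℝ := ψ z₁ with hR₀
  have hR0 : 0 ≤ R₀ := abs_nonneg _
  have hRle : ∀ z ∈ closure s.domain, ψ z ≤ R₀ := fun z hz => hmax hz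
  have hRT : ∀ z : Fin (B + 1 + 1) → ℝ, (∀ j, 0 < affF B 1 (M j) z) → ∀ T : ℝ, affF B 1 u z < T →
      T < affF B 1 v z → |sR * (z (Fin.castAdd 1 (Fin.last B)) - affB B 1 ℓ₂ z)| ≤ R₀ := by
    intro z hz T hT1 hT2
    have hmem : Function.update z (tI B) T ∈ s.domain := by
      rw [hdom, mem_gDom_one]
      refine ⟨fun j => by rw [affF_update_tI]; exact hz j, ?_, ?_⟩
      · rw [affF_update_tI, show Fin.natAdd (B + 1) 0 = tI B from rfl, Function.update_self]
        exact hT1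
      · rw [affF_update_tI, show Fin.natAdd (B + 1) 0 = tI B from rfl, Function.update_self]
        exact hT2
    have h := hRle _ (subset_closure hmem)
    rw [hψ] at h
    dsimp only at h
    rwa [affB_update_tI, Function.update_of_ne (castAdd_ne_tI (Fin.last B))] at h
  -- where `h < μ` and `w < μ` on the base cell, `μ ≤ |κ'|`
  have hklow : ∀ z : Fin (B + 1 + 1) → ℝ, (∀ j, 0 < affF B 1 (M j) z) → affB B 1 hF z < μ →
      affB B 1 wF z < μ → μ ≤ |affB B 1 kF z| := by
    intro z hz hlt hlt'
    obtain ⟨-, huv⟩ := hcell z hz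
    have hz'dom : Function.update z (tI B) ((affF B 1 u z + affF B 1 v z) / 2) ∈ s.domain := by
      rw [hdom, mem_gDom_one]
      refine ⟨fun j => by rw [affF_update_tI]; exact hz j, ?_, ?_⟩
      · rw [affF_update_tI, show Fin.natAdd (B + 1) 0 = tI B from rfl, Function.update_self]
        linarith
      · rw [affF_update_tI, show Fin.natAdd (B + 1) 0 = tI B from rfl, Function.update_self]
        linarith
    have h := hμle _ (subset_closure hz'dom)
    rw [hφ] at h
    dsimp only at h
    rw [affB_update_tI, affB_update_tI, affB_update_tI] at h
    rcases le_max_iff.1 h with h' | h'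
    · rcases le_max_iff.1 h' with h'' | h'' <;> linarith
    · exact h'
  -- the cut level `δ`
  obtain ⟨δ, hδ0, hδμ, hδs⟩ : ∃ δ : ℚ, (0 : ℝ) < δ ∧ (δ : ℝ) < μ ∧ |sR| * δ < μ / 2 := by
    obtain ⟨δ, h0, h1⟩ := exists_rat_btwn (lt_min hμ0 (div_pos (half_pos hμ0) hs0))
    refine ⟨δ, h0, lt_of_lt_of_le h1 (min_le_left _ _), ?_⟩
    have h2 := lt_of_lt_of_le h1 (min_le_right _ _)
    rwa [lt_div_iff₀ hs0, mul_comm] at h2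
  -- cut 1: at `h = δ`
  set g₁ : (Fin B → ℚ) × ℚ := hF - ((0 : Fin B → ℚ), δ) with hg₁
  have hg₁z : ∀ z : Fin (B + 1 + 1) → ℝ, affB B 1 g₁ z = affB B 1 hF z - δ := fun z => by
    rw [hg₁, affB_sub, affB_const]
  have hg₁ne : g₁ ≠ 0 := fun h0 => ha0 (by simpa [hg₁] using congrArg Prod.fst h0)
  obtain ⟨s₁, s₂, hsub₁, hsub₂, hi₁, hi₂, hd₁, hd₂, hsec₁, hsec₂, hrel₁⟩ :=
    cutCell s M M₀ ylo yhi u v hdom hsec g₁ hg₁ne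
  refine good_of_split hrel₁ ?_ ?_
  · -- far part `h > δ`: non-pinching
    refine good_parNonpinch' L e ℓ₁ ℓ₂ s₁ _ (Fin.snoc M₀ g₁) ylo yhi p u v (hbd.subset hsub₁) hd₁
      (by rw [hi₁]; exact hint.mono hsub₁) hu hpar (fun z hz => hcell z (rows_snoc hz).1) hsec₁
      ⟨δ, hδ0, fun z hz => ?_⟩
    have h := (rowsB_snoc_iff.1 hz).2
    rw [hg₁z, hhz] at h
    linarith
  -- near part `h < δ`; cut 2: by `w = |s| h`
  set g₂ : (Fin B → ℚ) × ℚ := wF - |sq| • hF with hg₂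
  have hg₂z : ∀ z : Fin (B + 1 + 1) → ℝ, affB B 1 g₂ z =
      (affF B 1 v z - affF B 1 u z) - |sR| * (affB B 1 yhi z - affB B 1 ylo z) := fun z => by
    rw [hg₂, hwF, hhF, hsR, hsq, affB_levelForm ylo yhi u v hpar z]
  have hnear₂ : ∀ z : Fin (B + 1 + 1) → ℝ, (∀ j, 0 < affB B 1 ((Fin.snoc M₀ (-g₁) : Fin (m₀ + 1) → _) j) z) →
      (∀ j, 0 < affB B 1 (M₀ j) z) ∧ affB B 1 hF z < δ := fun z hz => by
    obtain ⟨h0, h1⟩ := rowsB_snoc_iff.1 hz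
    rw [affB_neg', hg₁z] at h1
    exact ⟨h0, by linarith⟩
  by_cases hg₂0 : g₂ = 0
  · refine good_parLevel L e ℓ₁ ℓ₂ 0 1 (Fin.snoc M₀ (-g₁)) yhi p u v (Or.inl rfl) hpar 0 s₂ _ ylo
      (hbd.subset hsub₂) hd₂ (by rw [hi₂]; exact hint.mono hsub₂) (fun z hz => (hsec₂ z).1 hz) fun z _ => ?_
    have h := hg₂z z
    rw [hg₂0, affB_zeroYT] at h
    rw [Nat.cast_zero, zero_add, one_mul]
    linarith
  obtain ⟨s₃, s₄, hsub₃, hsub₄, hi₃, hi₄, hd₃, hd₄, hsec₃, hsec₄, hrel₂⟩ :=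
    cutCell s₂ _ (Fin.snoc M₀ (-g₁)) ylo yhi u v hd₂ hsec₂ g₂ hg₂0
  have hint₂ : EqOn s₂.integrand (glit B 1 p L e ℓ₁ ℓ₂ 0 1 (fun _ => some 0)) s₂.domain := by
    rw [hi₂]; exact hint.mono hsub₂
  refine good_of_split hrel₂ ?_ ?_
  · -- `|s| h < w`: one level split
    refine good_parLevel L e ℓ₁ ℓ₂ 0 1 (Fin.snoc (Fin.snoc M₀ (-g₁)) g₂) yhi p u v (Or.inl rfl) hpar 0 s₃ _ ylo
      ((hbd.subset hsub₂).subset hsub₃) hd₃ (by rw [hi₃]; exact hint₂.mono hsub₃) (fun z hz => (hsec₃ z).1 hz)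
      fun z hz => ?_
    obtain ⟨⟨-, hgp⟩, -, -⟩ := (hsec₃ z).1 hz |>.imp_left rowsB_snoc_iff.1
    rw [hg₂z] at hgp
    rw [Nat.cast_zero, zero_add, one_mul]
    linarith
  -- `w < |s| h < |s| δ < μ/2`; cut 3: by the sign of `κ'`
  have hnear₄ : ∀ z : Fin (B + 1 + 1) → ℝ,
      (∀ j, 0 < affB B 1 ((Fin.snoc (Fin.snoc M₀ (-g₁)) (-g₂) : Fin (m₀ + 1 + 1) → _) j) z) →
      (∀ j, 0 < affB B 1 (M₀ j) z) ∧ affB B 1 hF z < δ ∧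
        affF B 1 v z - affF B 1 u z < |sR| * (affB B 1 yhi z - affB B 1 ylo z) ∧
        affF B 1 v z - affF B 1 u z < μ / 2 := fun z hz => by
    obtain ⟨h0, h2⟩ := rowsB_snoc_iff.1 hz
    obtain ⟨h00, h1⟩ := hnear₂ z h0
    rw [affB_neg', hg₂z] at h2
    refine ⟨h00, h1, by linarith, ?_⟩
    have h3 : |sR| * (affB B 1 yhi z - affB B 1 ylo z) < |sR| * δ := by
      rw [← hhz]; exact mul_lt_mul_of_pos_left h1 hs0
    linarith
  have hrows₄ : ∀ z : Fin (B + 1 + 1) → ℝ,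
      (∀ j, 0 < affB B 1 ((Fin.snoc (Fin.snoc M₀ (-g₁)) (-g₂) : Fin (m₀ + 1 + 1) → _) j) z) →
      affB B 1 ylo z < z (Fin.castAdd 1 (Fin.last B)) → z (Fin.castAdd 1 (Fin.last B)) < affB B 1 yhi z →
      μ ≤ |affB B 1 kF z| := fun z hz hlo hhi => by
    obtain ⟨h0, h1, -, h3⟩ := hnear₄ z hz
    have hM : ∀ j, 0 < affF B 1 (M j) z := (hsec z).2 ⟨h0, hlo, hhi⟩
    exact hklow z hM (by linarith) (by rw [hwz]; linarith)
  have hint₄ : EqOn s₄.integrand (glit B 1 p L e ℓ₁ ℓ₂ 0 1 (fun _ => some 0)) s₄.domain := by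
    rw [hi₄]; exact hint₂.mono hsub₄
  have hbd₄ : Bornology.IsBounded s₄.domain := (hbd.subset hsub₂).subset hsub₄
  -- `μ ≤ |κ'|` on the `x'`-cell of `s₄` (move `y` to the middle of the range)
  have hmid : ∀ z : Fin (B + 1 + 1) → ℝ,
      (∀ j, 0 < affB B 1 ((Fin.snoc (Fin.snoc M₀ (-g₁)) (-g₂) : Fin (m₀ + 1 + 1) → _) j) z) →
      μ ≤ |affB B 1 kF z| := fun z h0 => by
    set z' : Fin (B + 1 + 1) → ℝ :=
      Function.update z (Fin.castAdd 1 (Fin.last B)) ((affB B 1 ylo z + affB B 1 yhi z) / 2) with hz'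
    have hx : ∀ d : (Fin B → ℚ) × ℚ, affB B 1 d z' = affB B 1 d z := fun d => affB_update_y d z _
    have hy : z' (Fin.castAdd 1 (Fin.last B)) = (affB B 1 ylo z + affB B 1 yhi z) / 2 := by
      rw [hz', Function.update_self]
    have hlt := hne z (hnear₄ z h0).1
    have h := hrows₄ z' (fun j => by rw [hx]; exact h0 j) (by rw [hx, hy]; linarith) (by rw [hx, hy]; linarith)
    rwa [hx] at h
  by_cases hk0 : kF = 0
  · -- `κ' = 0` identically: the piece is empty
    refine good_of_null s₄ ?_
    rw [hd₄]
    refine measure_mono_null (fun z hz => ?_) measure_empty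
    obtain ⟨h0, hlo, hhi⟩ := (hsec₄ z).1 ((mem_gDom_one _ u v z).1 hz).1
    have h := hrows₄ z h0 hlo hhi
    rw [hk0, affB_zeroYT, abs_zero] at h
    exact absurd h (not_le.2 hμ0)
  obtain ⟨s₅, s₆, hsub₅, hsub₆, hi₅, hi₆, hd₅, hd₆, hsec₅, hsec₆, hrel₃⟩ :=
    cutCell s₄ _ (Fin.snoc (Fin.snoc M₀ (-g₁)) (-g₂)) ylo yhi u v hd₄ hsec₄ kF hk0
  refine good_of_split hrel₃ ?_ ?_
  · -- `κ' > 0`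
    refine good_parCell_offCoincidence L e ℓ₁ ℓ₂ s₅ _ _ ylo yhi p u v (hbd₄.subset hsub₅) hd₅
      (by rw [hi₅]; exact hint₄.mono hsub₅) hu hpar
      (fun z hz => hcell z (rows_snoc (rows_snoc (rows_snoc hz).1).1).1) hsec₅
      (fun z hz => hne z (hnear₄ z (rowsB_snoc_iff.1 hz).1).1)
      (fun z hz => hpole z (hnear₄ z (rowsB_snoc_iff.1 hz).1).1) μ R₀ 1 hμ0 hR0 (Or.inl rfl)
      (fun z hz => ?_) (fun z hz => ?_)
      (fun z hz T hT1 hT2 => hRT z (rows_snoc (rows_snoc (rows_snoc hz).1).1).1 T hT1 hT2)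
    · obtain ⟨h0, hk⟩ := rowsB_snoc_iff.1 hz
      have h := hmid z h0
      rw [hkz] at hk h
      rw [one_mul]
      rwa [abs_of_pos hk] at h
    · obtain ⟨h0, -⟩ := rowsB_snoc_iff.1 hz
      obtain ⟨-, -, h2, h3⟩ := hnear₄ z h0
      exact ⟨h2, h3.le⟩
  · -- `κ' < 0`
    refine good_parCell_offCoincidence L e ℓ₁ ℓ₂ s₆ _ _ ylo yhi p u v (hbd₄.subset hsub₆) hd₆
      (by rw [hi₆]; exact hint₄.mono hsub₆) hu hpar
      (fun z hz => hcell z (rows_snoc (rows_snoc (rows_snoc hz).1).1).1) hsec₆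
      (fun z hz => hne z (hnear₄ z (rowsB_snoc_iff.1 hz).1).1)
      (fun z hz => hpole z (hnear₄ z (rowsB_snoc_iff.1 hz).1).1) μ R₀ (-1) hμ0 hR0 (Or.inr rfl)
      (fun z hz => ?_) (fun z hz => ?_)
      (fun z hz T hT1 hT2 => hRT z (rows_snoc (rows_snoc (rows_snoc hz).1).1).1 T hT1 hT2)
    · obtain ⟨h0, hk⟩ := rowsB_snoc_iff.1 hz
      rw [affB_neg'] at hk
      have h := hmid z h0
      have hneg : affB B 1 (restr B u) z + sR * affB B 1 ℓ₂ z < 0 := by rw [← hkz]; linarith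
      rw [hkz, abs_of_neg hneg] at h
      rw [neg_one_mul]
      exact h
    · obtain ⟨h0, -⟩ := rowsB_snoc_iff.1 hz
      obtain ⟨-, -, h2, h3⟩ := hnear₄ z h0
      exact ⟨h2, h3.le⟩

end Triple

end RebasePos

/-- **Registered part of `stub_rebaseSimplePosOnePos`, residual hypothesis `HparFlat` (line
`janus-bands`): a product cell WITHOUT TRIPLE POINT is closed** (any base dimension; data of
`Hpar` over a product cell `{x'-rows M₀} × (ylo, yhi)` with non-degenerate `y`-range and the pole
outside it; no point of the closed cell has `ylo = yhi`, `u = v` and `u₀ + s ℓ₂ = 0`):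
`[s] ∈ closure (GG B 2 1)` modulo `KZ.relations` (`RebasePos.good_parCell_of_noTriple`). -/
theorem rebaseSimplePos_par_noTriple (B m m' m₀ : ℕ) (s : KZ.IntegralRep (B + 1 + 1)) (M : Fin m' → (Fin (B + 1) → ℚ) × ℚ) (M₀ : Fin m₀ → (Fin B → ℚ) × ℚ) (ylo yhi : (Fin B → ℚ) × ℚ) (L : Fin m → (Fin B → ℚ) × ℚ) (e : Fin m → ℕ) (p : MvPolynomial (Fin B) ℚ) (ℓ₁ ℓ₂ : (Fin B → ℚ) × ℚ) (u v : (Fin (B + 1) → ℚ) × ℚ) (hbd : Bornology.IsBounded s.domain) (hdom : s.domain = SeparatePos.gDom B 1 m' M (fun _ => Sum.inr u) (fun _ => Sum.inr v)) (hint : Set.EqOn s.integrand (RebasePos.glit B 1 p L e ℓ₁ ℓ₂ 0 1 (fun _ => some 0)) s.domain) (hu : u.1 (Fin.last B) ≠ 0) (hpar : u.1 (Fin.last B) = v.1 (Fin.last B)) (hcell : ∀ z : Fin (B + 1 + 1) → ℝ, (∀ j, 0 < SeparatePos.affF B 1 (M j) z) → 0 < SeparatePos.affF B 1 u z ∧ SeparatePos.affF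 B 1 u z < SeparatePos.affF B 1 v z) (hsec : ∀ z : Fin (B + 1 + 1) → ℝ, (∀ j, 0 < SeparatePos.affF B 1 (M j) z) ↔ ((∀ j, 0 < SeparatePos.affB B 1 (M₀ j) z) ∧ SeparatePos.affB B 1 ylo z < z (Fin.castAdd 1 (Fin.last B)) ∧ z (Fin.castAdd 1 (Fin.last B)) < SeparatePos.affB B 1 yhi z)) (hne : ∀ z : Fin (B + 1 + 1) → ℝ, (∀ j, 0 < SeparatePos.affB B 1 (M₀ j) z) → SeparatePos.affB B 1 ylo z < SeparatePos.affB B 1 yhi z) (hpole : ∀ z : Fin (B + 1 + 1) → ℝ, (∀ j, 0 < SeparatePos.affB B 1 (M₀ j) z) → SeparatePos.affB B 1 ℓ₂ z ≤ SeparatePos.affB B 1 ylo z ∨ SeparatePos.affB B 1 yhi z ≤ SeparatePos.affB B 1 ℓ₂ z) (hnt : ∀ z ∈ closure {z : Fin (B + 1 + 1) → ℝ | ∀ j, 0 < SeparatePos.affF B 1 (M j) z}, SeparatePos.affB B 1 ylo z = SeparatePos.affB B 1 yhi z → SeparatePos.affF B 1 u z = SeparatePos.affF B 1 v z → SeparatePos.affB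 B 1 (SeparatePos.restr B u) z + (u.1 (Fin.last B) : ℝ) * SeparatePos.affB B 1 ℓ₂ z = 0 → False) : ∃ c ∈ AddSubgroup.closure (SeparatePos.GGset B 2 1), KZ.of s - c ∈ KZ.relations :=
  RebasePos.good_parCell_of_noTriple L e ℓ₁ ℓ₂ s M M₀ ylo yhi p u v hbd hdom hint hu hpar hcell hsec hne hpole hnt

end Summit.KontsevichZagierPeriods.ArrangementNormalForm.JanusBands
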